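import Summits.RiemannHypothesis.RiemannHypothesis.Theorems.RuelleBandExactFirstBandStubEvenCriterion
import Literature.NumberTheory.LFunctions.WeilGroundEnergyParitySplit
import Literature.NumberTheory.LFunctions.WeilGroundStateRealZerosProofs
import HarnessLib

/-!
# Even negativity off the line (route `RiemannHypothesis/GroundBarta`, rung 3 `PolarPerronFrobenius`,
stmt-RiemannHypothesis-18390 — the even twin of the support item `OddNegativityOffLine`,
stmt-RiemannHypothesis-18391 / OddSector stmt-RiemannHypothesis-17780)

The in-tree EVEN Weil criterion (`RuelleBandExactFirstBand.riemannHypothesis_iff_evenWeilPositivity`: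
RH holds iff `Re W(g ⋆ g̃) ≥ 0` for every smooth compactly supported EVEN REAL-valued `g`) in
contrapositive, normalised, window-uniform form: if RH fails there are `η > 0` and `A` such that
EVERY window `a ≥ A` carries an `L²`-normalised smooth EVEN test `h` supported in `[-a, a]` with
`Re Q(h) ≤ -η` (`evenNegativityOffLine`); in energy form `ε_ev(a) ≤ -η` for `a ≥ A`
(`weilEvenGroundEnergy_le_neg_of_not_riemannHypothesis`).  Proof = the proof of
`oddNegativityOffLine_proof` (Theorems/OddSectorOddNegativityOffLine.lean) with the even criterion:
one even witness `g` with `Re Q(g) < 0`, normalised by `‖g‖₂⁻¹`, serves every window containing its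
support.  With the EVEN-SECTOR Barta floor (Theorems/GroundBartaPolarPerronFrobeniusEvenFloor.lean)
this is the detector of the parity-free deciding theorem
(Theorems/GroundBartaPolarPerronFrobeniusEvenSectorDeciding.lean).  The last theorem
`evenNegativityOffLine_routeForm` is, token for token, the statement of item `EvenNegativityOffLine`
(stmt-RiemannHypothesis-19956) of the draft route `EvenSectorBarta` (closable there by `Iff.rfl`
transport).  RH-free (a statement about `¬RH`).
References: H. Yoshida (1992) [Yoshida1992HermitianForms, Prop. 1]; E. Bombieri (2000)
[Bombieri2000Weil, §5].
-/

set_option linter.dupNamespace false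

noncomputable section

open Set MeasureTheory Filter Complex
open scoped Real Topology ComplexConjugate

namespace Summit.RiemannHypothesis.RiemannHypothesis.Theorems.PolarPerronFrobenius

open Literature.NumberTheory.LFunctions
open Summit.RiemannHypothesis.RiemannHypothesis.Theorems.RuelleBandExactFirstBand

/-- **First lemma.** If the Riemann hypothesis fails, some smooth compactly supported EVEN
REAL-valued `g` has `Re W(g ⋆ g̃) < 0`: contrapositive of the in-tree even Weil criterion
`riemannHypothesis_iff_evenWeilPositivity`. [cite: Yoshida1992HermitianForms, Prop. 1] -/
theorem evenNegativity_exists_even_real_neg (hRH : ¬ RiemannHypothesis) :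
    ∃ g : ℝ → ℂ, IsWeilTest g ∧ (∀ t : ℝ, g (-t) = g t) ∧ (∀ t : ℝ, (g t).im = 0) ∧
      (weilQuadratic g).re < 0 := by
  by_contra hne
  push Not at hne
  exact hRH (riemannHypothesis_iff_evenWeilPositivity.2 fun g hg hev hreal => hne g hg hev hreal)

/-- **Even negativity off the line, window-uniform.**  If RH fails there are `η > 0` and `A` such
that every window `a ≥ A` carries an `L²`-normalised smooth EVEN test `h` supported in `[-a, a]`
with `Re Q(h) ≤ -η`: take the even witness `g` of `evenNegativity_exists_even_real_neg`
(`g ≠ 0` since `Q(0) = 0`), normalise by `c = ‖g‖₂⁻¹` (`Q(c g) = c² Q(g) < 0`,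
`weilQuadratic_const_mul`), put `η := -Re Q(c g)` and let `A` be a support radius of `g`; larger
windows contain the support.  Even twin of `oddNegativityOffLine_proof`.
[cite: Yoshida1992HermitianForms, Prop. 1] -/
theorem evenNegativityOffLine (hRH : ¬ RiemannHypothesis) :
    ∃ η : ℝ, 0 < η ∧ ∃ A : ℝ, ∀ a : ℝ, A ≤ a → ∃ h : ℝ → ℂ,
      IsWeilTest h ∧ tsupport h ⊆ Icc (-a) a ∧ (∀ t, h (-t) = h t) ∧
      ∫ t, ‖h t‖ ^ 2 = (1 : ℝ) ∧ (weilQuadratic h).re ≤ -η := by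
  -- adapted from `oddNegativityOffLine_proof` (Theorems/OddSectorOddNegativityOffLine.lean)
  obtain ⟨g, hg, heven, -, hneg⟩ := evenNegativity_exists_even_real_neg hRH
  have hN2nn : 0 ≤ ∫ t : ℝ, ‖g t‖ ^ 2 := integral_nonneg fun _ => by positivity
  have hpos : 0 < ∫ t : ℝ, ‖g t‖ ^ 2 := by
    rcases hN2nn.eq_or_lt with hz | hpos
    · exfalso
      have hg0 : g = 0 := hg.eq_zero_of_integral_norm_sq_eq_zero hz.symm
      subst hg0
      rw [weilQuadratic_zero, Complex.zero_re] at hneg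
      exact lt_irrefl _ hneg
    · exact hpos
  set N2 : ℝ := ∫ t : ℝ, ‖g t‖ ^ 2 with hN2
  set c : ℝ := (Real.sqrt N2)⁻¹ with hc
  have hcpos : 0 < c := inv_pos.2 (Real.sqrt_pos.2 hpos)
  have hht : IsWeilTest fun t => (c : ℂ) * g t := hg.const_mul c
  have hnorm : ∫ t : ℝ, ‖(c : ℂ) * g t‖ ^ 2 = 1 := by
    simp only [norm_mul, mul_pow, Complex.norm_real, Real.norm_of_nonneg hcpos.le]
    rw [integral_const_mul, hc, inv_pow, Real.sq_sqrt hN2nn, inv_mul_cancel₀ hpos.ne']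
  have hQ : (weilQuadratic fun t => (c : ℂ) * g t).re = c * c * (weilQuadratic g).re := by
    rw [weilQuadratic_const_mul, Complex.normSq_ofReal, Complex.re_ofReal_mul]
  have hQneg : (weilQuadratic fun t => (c : ℂ) * g t).re < 0 := by
    rw [hQ]; exact mul_neg_of_pos_of_neg (mul_pos hcpos hcpos) hneg
  obtain ⟨r, hr⟩ := hg.2.isCompact.isBounded.subset_closedBall (0 : ℝ)
  refine ⟨-(weilQuadratic fun t => (c : ℂ) * g t).re, by linarith, r, fun a ha => ?_⟩
  refine ⟨fun t => (c : ℂ) * g t, hht, ?_, fun t => ?_, hnorm, by linarith⟩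
  · refine tsupport_mul_subset_right.trans (hr.trans ?_)
    rw [Real.closedBall_eq_Icc, zero_sub, zero_add]
    exact Set.Icc_subset_Icc (neg_le_neg ha) ha
  · show (c : ℂ) * g (-t) = (c : ℂ) * g t
    rw [heven]

/-- **Energy form**: if RH fails there are `η > 0` and `A` with `ε_ev(a) ≤ -η` for every window
`a ≥ A` (`weilEvenGroundEnergy_le` on the witness of `evenNegativityOffLine`).
[cite: Yoshida1992HermitianForms, Prop. 1] -/
theorem weilEvenGroundEnergy_le_neg_of_not_riemannHypothesis (hRH : ¬ RiemannHypothesis) :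
    ∃ η : ℝ, 0 < η ∧ ∃ A : ℝ, ∀ a : ℝ, A ≤ a → weilEvenGroundEnergy a ≤ -η := by
  obtain ⟨η, hη, A, hA⟩ := evenNegativityOffLine hRH
  refine ⟨η, hη, A, fun a ha => ?_⟩
  obtain ⟨h, hh, hs, hev, hn, hle⟩ := hA a ha
  exact (weilEvenGroundEnergy_le hh hs hev hn).trans hle

/-- **Eventually-form**: if RH fails, `ε_ev(a) ≤ -η < 0` for all large windows. [folklore] -/
theorem eventually_weilEvenGroundEnergy_le_neg_of_not_riemannHypothesis
    (hRH : ¬ RiemannHypothesis) :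
    ∃ η : ℝ, 0 < η ∧ ∀ᶠ a in atTop, weilEvenGroundEnergy a ≤ -η := by
  obtain ⟨η, hη, A, hA⟩ := weilEvenGroundEnergy_le_neg_of_not_riemannHypothesis hRH
  exact ⟨η, hη, eventually_atTop.2 ⟨A, hA⟩⟩

/-- **Route form (draft route `EvenSectorBarta`, item `EvenNegativityOffLine`,
stmt-RiemannHypothesis-19956), token for token**: `IsWeilTest` spelled `ContDiff ℝ ∞ ∧
HasCompactSupport` and `Q = weilQuadratic` spelled by its `let C … let M … let Q …` prelude; the
statement is definitionally `evenNegativityOffLine` (`show`). [folklore] -/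
theorem evenNegativityOffLine_routeForm :
    (let C : (ℝ → ℂ) → ℝ → ℂ := fun g => MeasureTheory.convolution g (fun t => (starRingEnd ℂ) (g (-t))) (ContinuousLinearMap.mul ℂ ℂ) MeasureTheory.MeasureSpace.volume; let M : (ℝ → ℂ) → ℂ → ℂ := fun F s => ∫ t : ℝ, F t * Complex.exp ((s - 1 / 2) * t); let Q : (ℝ → ℂ) → ℂ := fun g => M (C g) 0 + M (C g) 1 - (∑' n : ℕ, ((ArithmeticFunction.vonMangoldt n : ℝ) : ℂ) / (Real.sqrt n : ℂ) * (C g (Real.log n) + C g (-Real.log n))) + ((1 / (2 * Real.pi) : ℂ) * (∫ t : ℝ, M (C g) (1 / 2 + t * Complex.I) * ((Complex.digamma (1 / 4 + t / 2 * Complex.I)).re : ℂ)) - C g 0 * (Real.log Real.pi : ℂ)); ¬ RiemannHypothesis → ∃ η : ℝ, 0 < η ∧ ∃ A : ℝ, ∀ a : ℝ, A ≤ a → ∃ h : ℝ → ℂ, (ContDiff ℝ ((⊤ : ℕ∞) : WithTop ℕ∞) h ∧ HasCompactSupport h) ∧ tsupport h ⊆ Set.Icc (-a) a ∧ (∀ t,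 h (-t) = h t) ∧ ∫ t, ‖h t‖ ^ 2 = (1 : ℝ) ∧ (Q h).re ≤ -η) := by
  show ¬ RiemannHypothesis → ∃ η : ℝ, 0 < η ∧ ∃ A : ℝ, ∀ a : ℝ, A ≤ a → ∃ h : ℝ → ℂ,
    IsWeilTest h ∧ tsupport h ⊆ Set.Icc (-a) a ∧ (∀ t, h (-t) = h t) ∧
    ∫ t, ‖h t‖ ^ 2 = (1 : ℝ) ∧ (weilQuadratic h).re ≤ -η
  exact evenNegativityOffLine

end Summit.RiemannHypothesis.RiemannHypothesis.Theorems.PolarPerronFrobenius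

end
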